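/-
Copyright (c) 2026 the pub-hodgecm-mathlib formalisation cell (harness21).  Prover seat hodgecm-mathlib-K2E3-p23 (g8), Track B «K2-LIT» ∕ hLiu418 #184♮,
Road I v3, unit U5 «THE CLOSE», FACE-D₀ row `h2₂`: THE S-LETTERS OF ★ U2a's σ-EXPLICIT LINE MODEL AT ONE FINITE PLACE `v` — PART 2b, THE LETTERS `hρm` ∕ `hu`
(the local reading at `v` of the `κ`-model's chirp matrix ★ p863869 `aMat_cMat_lineKappa_of_mem_unipDelta`).  THEOREMS ONLY.
-/
import Summits.HodgeConjecture.HodgeConjecture.Theorems.K2LiuFinLineModelLettersAtPlaceB   -- ★ p864126 PART 2a (brings ★ p864061 PART 1, ★ p863978, ★ p863656, ★ (d1))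
import Summits.HodgeConjecture.HodgeConjecture.Theorems.K2LiuFinChirpLocalReading         -- ★ p863605∕p863696 `finSdChar_map_finiteAdeleSingleHom`, the `ρf` ∃-package
import Summits.HodgeConjecture.HodgeConjecture.Theorems.K2LiuLinePairCayleySiegelUnipotent  -- ★ p863869 FILE 2c (the `cMat` bytes; brings `⅟(2 : 𝔸)`)
import HarnessLib

/-!
# K2_Liu road (hLiu418 = stmt-HodgeConjecture-24832), U5 «THE CLOSE», FACE-D₀ row `h2₂`: THE LETTERS `hρm` ∕ `hu` OF ★ U2a's LINE MODEL AT THE PLACE `v` —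
# THE LOCAL READING OF THE `κ`-MODEL's CHIRP MATRIX

Cell `pub/hodgecm-mathlib` (D-0151), Track B, build stream 29; helper lane `--supports stmt-HodgeConjecture-24832 --as helper`, count-neutral; closes no socket.
THEOREMS ONLY (no `def`, no `instance`, no notation, no named-fact hypothesis, no `sorry`).

The `κ`-model (K2Liu-p02 ★ p863770 ∕ p863896 ∕ TIE p863969, F0P2-p10 ★ p863869) makes `z ∈ N_Δ(L⁺_v)` act on `𝒮(𝔸_f^{n″})` by the finite chirp `finSdChar ((S z)_f)` with
`S z := (−⅟2) • cMat q_{ι_v z} = (−⅟2) • (1ᵀ · reindex e₁′ (reindex e₂ (a′ • (J₂ · Res(−X−X) · D₂(⅟2)))))`, `X = X(ι_v z)` (★ p863869's bytes).  THIS FILE reads that chirp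
at the place `v`:
* §1 ring-generic bookkeeping: a ring hom pushes through the chirp matrix (`map_chirpMatrix`), through `T⁻¹` (`map_nonsing_inv_eq`), and the quadratic form of a
  re-enumerated matrix is the quadratic form in the re-enumerated variable (`vecMul_reindex_dotProduct`);
* §2 at `v`: the `w`-component (`w ∤ v` finite) of `S z` VANISHES and the finite part of `S z` is the place-`v` inclusion of its `v`-component (`map_snd_chirp_eq`), whose
  quadratic form is ★ p863978 `chirpGram_eq_trace_of_blocks` — whence **`finSdChar_chirp_eq`**: `finSdChar ((S z)_f) x = ψ_{L⁺,v}(Tr tr(b z · (a • σ(y) ⊗ y)))` with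
  `b z = δ • X_v(z) T_v⁻¹` (★ p864061∕p864126's dressing), `a = ι_v(a′∕(4d))`, `y` the chirp vector of `x_v` split along `e₂ ≫ e₁′` — ★ U2a's letter `hρm` up to
  ★ p863605 `coe_finMulLM_finSdChar_map_finiteAdeleSingleHom`, and `hu` by ★ p863978 `isLocallyConstant_multiplier`.
References: [Kudla1994] §3; [Rallis1984] §4; [KudlaRallis1994] §3; [Weil1964] n° 13; [CasselsFrohlichANT1967] Ch. II §14, Ch. XV §2.2.
HONEST LABEL: HC_CM is proved only modulo the 7 printed citations (2 remaining named inputs: hLiu418 = stmt-HodgeConjecture-24832, h413 = stmt-HodgeConjecture-24833)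
until rung 0 closes; this file moves no counter; `h2₂` NOT discharged.
-/

set_option autoImplicit false
set_option linter.dupNamespace false -- the mandated namespace repeats `HodgeConjecture.HodgeConjecture`

noncomputable section

open scoped Matrix
open NumberField IsDedekindDomain
open Literature.NumberTheory.Automorphic Literature.NumberTheory.Automorphic.UnitaryGroup Literature.NumberTheory.GaloisRepresentations
open Literature.NumberTheory.Automorphic.UnitaryGroup.QuadraticCoordinates
open Literature.NumberTheory.GelbartRogawski1991 Literature.NumberTheory.GelbartRogawski1991.GRConstruction
open Literature.NumberTheory.GelbartRogawski1991.UnitaryDualPair (imagUnit imagUnitSq complexConj_imagUnit imagUnit_ne_zero imagUnit_mul_self isUnit_det_gram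
  isUnit_det_realDiagonal)
open Literature.NumberTheory.K2Lit.SiegelDoubled
open Literature.NumberTheory.Weil1964

namespace Summit.HodgeConjecture.HodgeConjecture.Cruxes.HLiu418.K2LiuFinLineModelLettersAtPlaceC

/-! ## §1 Ring-generic bookkeeping -/
section Generic

variable {A B : Type*} [CommRing A] [CommRing B] (f : A →+* B) {ι : Type*} [Fintype ι] [DecidableEq ι]

/-- a ring hom commutes with the inverse of a matrix with unit determinant. [folklore] -/
theorem map_nonsing_inv_eq (T : Matrix ι ι A) (hT : IsUnit T.det) : (T⁻¹).map f = (T.map f)⁻¹ :=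
  (Matrix.inv_eq_right_inv (by rw [← Matrix.map_mul, Matrix.mul_nonsing_inv T hT, Matrix.map_one _ (map_zero f) (map_one f)])).symm

/-- a ring hom pushes through the chirp matrix `a • (J₂ · Res(Zr, Zi) · D₂(h))`. [cite: Kudla1994, §3] -/
theorem map_chirpMatrix (a h d : A) (Zr Zi T Ti : Matrix ι ι A) :
    (a • (Matrix.fromBlocks 0 1 (-((2 : A) • (1 : Matrix ι ι A))) 0 * Matrix.fromBlocks Zr (d • (Zi * Ti)) (T * Zi) (T * Zr * Ti) *
        Matrix.fromBlocks (h • (1 : Matrix ι ι A)) 0 0 1)).map f =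
      f a • (Matrix.fromBlocks 0 1 (-((2 : B) • (1 : Matrix ι ι B))) 0 *
        Matrix.fromBlocks (Zr.map f) (f d • (Zi.map f * Ti.map f)) (T.map f * Zi.map f) (T.map f * Zr.map f * Ti.map f) *
        Matrix.fromBlocks (f h • (1 : Matrix ι ι B)) 0 0 1) := by
  rw [Matrix.map_smul' _ _ _ (map_mul f), Matrix.map_mul, Matrix.map_mul, Matrix.fromBlocks_map, Matrix.fromBlocks_map, Matrix.fromBlocks_map,
    Matrix.map_zero _ (map_zero f), Matrix.map_one _ (map_zero f) (map_one f), Matrix.map_neg _ (map_neg f), Matrix.map_smul' _ _ _ (map_mul f),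
    Matrix.map_smul' _ _ _ (map_mul f), Matrix.map_smul' _ _ _ (map_mul f), Matrix.map_one _ (map_zero f) (map_one f), map_ofNat, Matrix.map_mul,
    Matrix.map_mul, Matrix.map_mul, Matrix.map_mul]

omit [Fintype ι] [DecidableEq ι] in
/-- re-enumeration of the zero matrix. [folklore] -/
theorem reindex_zero {κ : Type*} (ε : ι ≃ κ) : Matrix.reindex ε ε (0 : Matrix ι ι A) = 0 := rfl

omit [Fintype ι] [DecidableEq ι] in
/-- a ring hom commutes with re-enumeration. [folklore] -/
theorem map_reindex {κ : Type*} (ε : ι ≃ κ) (M : Matrix ι ι A) : (Matrix.reindex ε ε M).map f = Matrix.reindex ε ε (M.map f) := rfl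

omit [DecidableEq ι] in
/-- **the quadratic form of a re-enumerated matrix is the quadratic form in the re-enumerated variable**:
`⟨x · reindex ε ε M, x⟩ = ⟨(x ∘ ε) · M, x ∘ ε⟩`. [folklore] -/
theorem vecMul_reindex_dotProduct {κ : Type*} [Fintype κ] (ε : ι ≃ κ) (M : Matrix ι ι A) (x : κ → A) :
    (x ᵥ* Matrix.reindex ε ε M) ⬝ᵥ x = ((x ∘ ε) ᵥ* M) ⬝ᵥ (x ∘ ε) := by
  simp only [dotProduct, Matrix.vecMul, Matrix.reindex_apply, Matrix.submatrix_apply, Function.comp_apply]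
  rw [← Equiv.sum_comp ε]
  refine Finset.sum_congr rfl fun j _ => ?_
  rw [← Equiv.sum_comp ε]
  simp only [Equiv.symm_apply_apply]

omit [CommRing A] [Fintype ι] [DecidableEq ι] in
/-- splitting a vector on `ι ⊕ ι` into its two halves. [folklore] -/
theorem sumElim_comp_inl_inr (x : ι ⊕ ι → A) : Sum.elim (x ∘ Sum.inl) (x ∘ Sum.inr) = x :=
  Sum.elim_comp_inl_inr x

end Generic

/-! ## §2 At the place `v`: support and the local reading of the chirp matrix -/
section Instance

variable (L : Type) [Field L] [NumberField L] [IsCMField L]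
variable {N M n : ℕ} (e : Fin N × Fin M ≃ Fin n)
  (dV : Fin N → L) (hdV : ∀ i, IsCMField.complexConj L (dV i) = dV i)
  (dW : Fin M → L) (hdW : ∀ i, IsCMField.complexConj L (dW i) = dW i)
  (v : HeightOneSpectrum (𝓞 (Fp L)))

/-- **a finite place `w` of `L⁺` pushed through ★ p863869's chirp matrix**: the `w`-component of `a′ • (J₂ · Res(−X−X) · D₂(⅟2))` is the same expression in the
LOCAL coordinates at `w` of `(−X−X)|_w` (★ p863978 §2 `map_re∕im_quadraticAdeleEquiv_snd_apply`; `T⁻¹` through ★ `isUnit_det_gram`). [cite: Kudla1994, §3]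
[cite: CasselsFrohlichANT1967, Ch. II §14] -/
theorem map_adeleEval_chirpMatrix (hdV0 : ∀ i, dV i ≠ 0) (hdW0 : ∀ i, dW i ≠ 0) (a' : (Fp L)ˣ) (w : HeightOneSpectrum (𝓞 (Fp L)))
    (X : Matrix (Fin n) (Fin n) (AdeleRing (𝓞 L) L)) :
    ((algebraMap (Fp L) (AdeleRing (𝓞 (Fp L)) (Fp L)) (a' : Fp L)) •
        (Matrix.fromBlocks 0 1 (-((2 : (AdeleRing (𝓞 (Fp L)) (Fp L))) • (1 : Matrix (Fin n) (Fin n) (AdeleRing (𝓞 (Fp L)) (Fp L))))) 0 *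
          Matrix.fromBlocks ((-X - X).map (re (quadraticAdeleEquiv (Fp L) L (IsCMField.complexConj L) (complexConj_imagUnit L) (imagUnit_ne_zero L)).toAddEquiv)) ((algebraMap (Fp L) (AdeleRing (𝓞 (Fp L)) (Fp L)) (imagUnitSq L)) • ((-X - X).map (im (quadraticAdeleEquiv (Fp L) L (IsCMField.complexConj L) (complexConj_imagUnit L) (imagUnit_ne_zero L)).toAddEquiv) * ((gramR L e dV hdV dW hdW).map (algebraMap (Fp L) (AdeleRing (𝓞 (Fp L)) (Fp L))))⁻¹))
            (((gramR L e dV hdV dW hdW).map (algebraMap (Fp L) (AdeleRing (𝓞 (Fp L)) (Fp L)))) * (-X - X).map (im (quadraticAdeleEquiv (Fp L) L (IsCMField.complexConj L) (complexConj_imagUnit L) (imagUnit_ne_zero L)).toAddEquiv)) (((gramR L e dV hdV dW hdW).map (algebraMap (Fp L) (AdeleRing (𝓞 (Fp L)) (Fp L)))) * (-X - X).map (re (quadraticAdeleEquiv (Fp L) L (IsCMField.complexConj L) (complexConj_imagUnit L) (imagUnit_ne_zero L)).toAddEquiv) * ((gramR L e dV hdV dW hdW).map (algebraMap (Fp L)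 (AdeleRing (𝓞 (Fp L)) (Fp L))))⁻¹) *
          Matrix.fromBlocks ((⅟(2 : (AdeleRing (𝓞 (Fp L)) (Fp L)))) • (1 : Matrix (Fin n) (Fin n) (AdeleRing (𝓞 (Fp L)) (Fp L)))) 0 0 1)).map (AdelicGroupData.adeleEval (Fp L) w) =
      ((a' : Fp L) : w.adicCompletion (Fp L)) •
        (Matrix.fromBlocks 0 1 (-((2 : (w.adicCompletion (Fp L))) • (1 : Matrix (Fin n) (Fin n) (w.adicCompletion (Fp L))))) 0 *
          Matrix.fromBlocks (((-X - X).map (fun t : AdeleRing (𝓞 L) L => finiteAdeleToLocal L w t.2)).map (re (quadraticLocalEquiv L w (IsCMField.complexConj L) (complexConj_imagUnit L) (imagUnit_ne_zero L)).toLinearEquiv.toAddEquiv)) (((imagUnitSq L : Fp L) : (w.adicCompletion (Fp L))) • (((-X - X).map (fun t : AdeleRing (𝓞 L) L => finiteAdeleToLocal L w t.2)).map (im (quadraticLocalEquiv L w (IsCMField.complexConj L) (complexConj_imagUnit L) (imagUnit_ne_zero L)).toLinearEquiv.toAddEquiv) * ((gramR L e dV hdV dW hdW).map (algebraMap (Fp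 L) (w.adicCompletion (Fp L))))⁻¹))
            (((gramR L e dV hdV dW hdW).map (algebraMap (Fp L) (w.adicCompletion (Fp L)))) * ((-X - X).map (fun t : AdeleRing (𝓞 L) L => finiteAdeleToLocal L w t.2)).map (im (quadraticLocalEquiv L w (IsCMField.complexConj L) (complexConj_imagUnit L) (imagUnit_ne_zero L)).toLinearEquiv.toAddEquiv)) (((gramR L e dV hdV dW hdW).map (algebraMap (Fp L) (w.adicCompletion (Fp L)))) * ((-X - X).map (fun t : AdeleRing (𝓞 L) L => finiteAdeleToLocal L w t.2)).map (re (quadraticLocalEquiv L w (IsCMField.complexConj L) (complexConj_imagUnit L) (imagUnit_ne_zero L)).toLinearEquiv.toAddEquiv) * ((gramR L e dV hdV dW hdW).map (algebraMap (Fp L) (w.adicCompletion (Fp L))))⁻¹) *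
          Matrix.fromBlocks ((AdelicGroupData.adeleEval (Fp L) w (⅟(2 : (AdeleRing (𝓞 (Fp L)) (Fp L))))) • (1 : Matrix (Fin n) (Fin n) (w.adicCompletion (Fp L)))) 0 0 1) := by
  have hT : ((gramR L e dV hdV dW hdW).map (algebraMap (Fp L) (AdeleRing (𝓞 (Fp L)) (Fp L)))).map (AdelicGroupData.adeleEval (Fp L) w) = ((gramR L e dV hdV dW hdW).map (algebraMap (Fp L) (w.adicCompletion (Fp L)))) := by
    rw [Matrix.map_map]
    exact congrArg (gramR L e dV hdV dW hdW).map (funext fun t => K2LiuTateCharacterLocalTrace.adeleEval_algebraMap_eq_coe (Fp L) w t)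
  have hTu : IsUnit ((gramR L e dV hdV dW hdW).map (algebraMap (Fp L) (AdeleRing (𝓞 (Fp L)) (Fp L)))).det :=
    K2LiuDoubledDarbouxDeltaBlocks.isUnit_det_gramRA L e dV hdV hdV0 dW hdW hdW0
  have hre : ((-X - X).map (re (quadraticAdeleEquiv (Fp L) L (IsCMField.complexConj L) (complexConj_imagUnit L) (imagUnit_ne_zero L)).toAddEquiv)).map (AdelicGroupData.adeleEval (Fp L) w) = ((-X - X).map (fun t : AdeleRing (𝓞 L) L => finiteAdeleToLocal L w t.2)).map (re (quadraticLocalEquiv L w (IsCMField.complexConj L) (complexConj_imagUnit L) (imagUnit_ne_zero L)).toLinearEquiv.toAddEquiv) :=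
    K2LiuFinChirpLocalGramReading.map_re_quadraticAdeleEquiv_snd_apply (Fp L) L w (IsCMField.complexConj L) (complexConj_imagUnit L) (imagUnit_ne_zero L) _
  have him : ((-X - X).map (im (quadraticAdeleEquiv (Fp L) L (IsCMField.complexConj L) (complexConj_imagUnit L) (imagUnit_ne_zero L)).toAddEquiv)).map (AdelicGroupData.adeleEval (Fp L) w) = ((-X - X).map (fun t : AdeleRing (𝓞 L) L => finiteAdeleToLocal L w t.2)).map (im (quadraticLocalEquiv L w (IsCMField.complexConj L) (complexConj_imagUnit L) (imagUnit_ne_zero L)).toLinearEquiv.toAddEquiv) :=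
    K2LiuFinChirpLocalGramReading.map_im_quadraticAdeleEquiv_snd_apply (Fp L) L w (IsCMField.complexConj L) (complexConj_imagUnit L) (imagUnit_ne_zero L) _
  rw [map_chirpMatrix, map_nonsing_inv_eq _ _ hTu, hT, hre, him, K2LiuTateCharacterLocalTrace.adeleEval_algebraMap_eq_coe,
    K2LiuTateCharacterLocalTrace.adeleEval_algebraMap_eq_coe]

/-- **OFF `v` THE CHIRP MATRIX OF `ι_v z` VANISHES**: for a finite place `w ≠ v` of `L⁺`, the `w`-component of `a′ • (J₂ · Res(−X−X) · D₂(⅟2))` at `X = X(ι_v z)` is `0`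
(every block carries a factor `re∕im` of `(−X−X)|_w = 0`, ★ p864061 `map_adeleEval_toBlocks₁₂_blk_locToAdelic_of_not_over`). [cite: CasselsFrohlichANT1967, Ch. II §14] -/
theorem map_adeleEval_chirpMatrix_of_ne (hdV0 : ∀ i, dV i ≠ 0) (hdW0 : ∀ i, dW i ≠ 0) (a' : (Fp L)ˣ)
    (z : UnitaryGroup.localPi L (IsCMField.complexConj L) (n + n) (hermD L e dV hdV dW hdW) v) (w : HeightOneSpectrum (𝓞 (Fp L))) (hw : w ≠ v) :
    ((algebraMap (Fp L) (AdeleRing (𝓞 (Fp L)) (Fp L)) (a' : Fp L)) •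
        (Matrix.fromBlocks 0 1 (-((2 : (AdeleRing (𝓞 (Fp L)) (Fp L))) • (1 : Matrix (Fin n) (Fin n) (AdeleRing (𝓞 (Fp L)) (Fp L))))) 0 *
          Matrix.fromBlocks ((-((blk L e dV hdV dW hdW (locToAdelic L e dV hdV dW hdW v z)).toBlocks₁₂) - ((blk L e dV hdV dW hdW (locToAdelic L e dV hdV dW hdW v z)).toBlocks₁₂)).map (re (quadraticAdeleEquiv (Fp L) L (IsCMField.complexConj L) (complexConj_imagUnit L) (imagUnit_ne_zero L)).toAddEquiv)) ((algebraMap (Fp L) (AdeleRing (𝓞 (Fp L)) (Fp L)) (imagUnitSq L)) • ((-((blk L e dV hdV dW hdW (locToAdelic L e dV hdV dW hdW v z)).toBlocks₁₂) - ((blk L e dV hdV dW hdW (locToAdelic L e dV hdV dW hdW v z)).toBlocks₁₂)).map (im (quadraticAdeleEquiv (Fp L) L (IsCMField.complexConj L) (complexConj_imagUnit L) (imagUnit_ne_zero L)).toAddEquiv) * ((gramR L e dV hdV dW hdW).map (algebraMap (Fp L) (AdeleRing (𝓞 (Fp L)) (Fp L))))⁻¹))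
            (((gramR L e dV hdV dW hdW).map (algebraMap (Fp L) (AdeleRing (𝓞 (Fp L)) (Fp L)))) * (-((blk L e dV hdV dW hdW (locToAdelic L e dV hdV dW hdW v z)).toBlocks₁₂) - ((blk L e dV hdV dW hdW (locToAdelic L e dV hdV dW hdW v z)).toBlocks₁₂)).map (im (quadraticAdeleEquiv (Fp L) L (IsCMField.complexConj L) (complexConj_imagUnit L) (imagUnit_ne_zero L)).toAddEquiv)) (((gramR L e dV hdV dW hdW).map (algebraMap (Fp L) (AdeleRing (𝓞 (Fp L)) (Fp L)))) * (-((blk L e dV hdV dW hdW (locToAdelic L e dV hdV dW hdW v z)).toBlocks₁₂) - ((blk L e dV hdV dW hdW (locToAdelic L e dV hdV dW hdW v z)).toBlocks₁₂)).map (re (quadraticAdeleEquiv (Fp L) L (IsCMField.complexConj L) (complexConj_imagUnit L) (imagUnit_ne_zero L)).toAddEquiv) * ((gramR L e dV hdV dW hdW).map (algebraMap (Fp L) (AdeleRing (𝓞 (Fp L)) (Fp L))))⁻¹) *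
          Matrix.fromBlocks ((⅟(2 : (AdeleRing (𝓞 (Fp L)) (Fp L)))) • (1 : Matrix (Fin n) (Fin n) (AdeleRing (𝓞 (Fp L)) (Fp L)))) 0 0 1)).map (AdelicGroupData.adeleEval (Fp L) w) = 0 := by
  have hX : ∀ u : UnitaryGroup.PlacesOver L w, (-((blk L e dV hdV dW hdW (locToAdelic L e dV hdV dW hdW v z)).toBlocks₁₂) - ((blk L e dV hdV dW hdW (locToAdelic L e dV hdV dW hdW v z)).toBlocks₁₂)).map (AdelicGroupData.adeleEval L u.1) = 0 := fun u => by
    rw [Matrix.map_sub _ (map_sub _), Matrix.map_neg _ (map_neg _),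
      K2LiuFinLineModelLettersAtPlace.map_adeleEval_toBlocks₁₂_blk_locToAdelic_of_not_over L e dV hdV dW hdW v z u.1 (by rw [u.2]; exact hw), neg_zero, sub_zero]
  have hZ : (-((blk L e dV hdV dW hdW (locToAdelic L e dV hdV dW hdW v z)).toBlocks₁₂) - ((blk L e dV hdV dW hdW (locToAdelic L e dV hdV dW hdW v z)).toBlocks₁₂)).map (fun t : AdeleRing (𝓞 L) L => finiteAdeleToLocal L w t.2) = 0 :=
    Matrix.ext fun i j => funext fun u => congrFun (congrFun (hX u) i) j
  rw [map_adeleEval_chirpMatrix L e dV hdV dW hdW hdV0 hdW0, hZ, Matrix.map_zero _ (map_zero _), Matrix.map_zero _ (map_zero _)]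
  simp only [Matrix.mul_zero, Matrix.zero_mul, smul_zero, Matrix.fromBlocks_zero]

omit [IsCMField L] in
/-- **an adelic matrix supported at `v` (among the finite places) has finite part equal to the place-`v` inclusion of its `v`-component.**
[cite: CasselsFrohlichANT1967, Ch. II §14] -/
theorem map_snd_eq_map_single {m : Type*} (N : Matrix m m (AdeleRing (𝓞 (Fp L)) (Fp L)))
    (hN : ∀ w : HeightOneSpectrum (𝓞 (Fp L)), w ≠ v → N.map (AdelicGroupData.adeleEval (Fp L) w) = 0) :
    N.map (RingHom.snd (InfiniteAdeleRing (Fp L)) (FiniteAdeleRing (𝓞 (Fp L)) (Fp L))) =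
      (N.map (AdelicGroupData.adeleEval (Fp L) v)).map (finiteAdeleSingleHom (Fp L) v) :=
  Matrix.ext fun i j => RestrictedProduct.ext _ _ fun w => by
    by_cases hw : w = v
    · subst hw
      show (N i j).2 w = finiteAdeleSingleHom (Fp L) w ((N i j).2 w) w
      rw [finiteAdeleSingleHom_apply_self]
    · show (N i j).2 w = finiteAdeleSingleHom (Fp L) v ((N i j).2 v) w
      rw [finiteAdeleSingleHom_apply_of_ne _ _ _ hw]
      exact congrFun (congrFun (hN w hw) i) j

set_option maxHeartbeats 400000 in -- the statement carries ★ p863869's adelic `cMat` bytes over the line datum; measured: 200000 RED (`whnf`), 400000 GREEN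
/-- **THE LOCAL READING OF THE `κ`-MODEL's CHIRP = ★ U2a's `hρm` ARGUMENT.**  For `z ∈ H(L⁺_v)` (only the block coordinate `X(ι_v z)` enters) and `x ∈ 𝔸_f^n″`: the
finite second-degree character of `S z := (−⅟2) • (1ᵀ · reindex e₁′ (reindex e₂ (a′ • (J₂ · Res(−X−X) · D₂(⅟2)))))` (★ p863869's `cMat q_{ι_v z}` bytes VERBATIM, `X = X(ι_v z)`)
at `x` is `ψ_{L⁺,v}(Tr_{L⊗L⁺_v∕L⁺_v} tr(b z · (a • σ(y) ⊗ y)))` with `b z = δ • X_v(z) T_v⁻¹` (the dressing of ★ p864061 ∕ p864126), `a = ι_v(a′∕(4d))` and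
`y_i = ι_v((p T_v)_i) − 2 ι_v(q_i) δ`, `(p, q) = x_v ∘ e₁′ ∘ e₂` (`S z` is supported at `v` with `v`-component §2; ★ p863605 `finSdChar_map_finiteAdeleSingleHom`;
★ p863978 `chirpGram_eq_trace_of_blocks`). [cite: Kudla1994, §3] [cite: Rallis1984, §4] [cite: Weil1964, n° 13] -/
theorem finSdChar_chirp_eq (hdV0 : ∀ i, dV i ≠ 0) (hdW0 : ∀ i, dW i ≠ 0) {n'' : ℕ} (e₁ : Fin (n + n) × Fin 1 ≃ Fin n'') (a' : (Fp L)ˣ)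
    (z : UnitaryGroup.localPi L (IsCMField.complexConj L) (n + n) (hermD L e dV hdV dW hdW) v) (x : Fin n'' → FiniteAdeleRing (𝓞 (Fp L)) (Fp L)) :
    finSdChar (((-⅟(2 : (AdeleRing (𝓞 (Fp L)) (Fp L)))) • ((1 : Matrix (Fin n'') (Fin n'') (AdeleRing (𝓞 (Fp L)) (Fp L)))ᵀ *
        Matrix.reindex ((Equiv.prodUnique (Fin (n + n)) (Fin 1)).symm.trans e₁) ((Equiv.prodUnique (Fin (n + n)) (Fin 1)).symm.trans e₁)
          (Matrix.reindex (e₂ (n := n)) (e₂ (n := n))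
          ((algebraMap (Fp L) (AdeleRing (𝓞 (Fp L)) (Fp L)) (a' : Fp L)) •
          (Matrix.fromBlocks 0 1 (-((2 : (AdeleRing (𝓞 (Fp L)) (Fp L))) • (1 : Matrix (Fin n) (Fin n) (AdeleRing (𝓞 (Fp L)) (Fp L))))) 0 *
          Matrix.fromBlocks ((-((blk L e dV hdV dW hdW (locToAdelic L e dV hdV dW hdW v z)).toBlocks₁₂) - ((blk L e dV hdV dW hdW (locToAdelic L e dV hdV dW hdW v z)).toBlocks₁₂)).map (re (quadraticAdeleEquiv (Fp L) L (IsCMField.complexConj L) (complexConj_imagUnit L) (imagUnit_ne_zero L)).toAddEquiv)) ((algebraMap (Fp L) (AdeleRing (𝓞 (Fp L)) (Fp L)) (imagUnitSq L)) • ((-((blk L e dV hdV dW hdW (locToAdelic L e dV hdV dW hdW v z)).toBlocks₁₂) - ((blk L e dV hdV dW hdW (locToAdelic L e dV hdV dW hdW v z)).toBlocks₁₂)).map (im (quadraticAdeleEquiv (Fp L) L (IsCMField.complexConj L) (complexConj_imagUnit L) (imagUnit_ne_zero L)).toAddEquiv) * ((gramR L e dV hdV dW hdW).map (algebraMap (Fp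 L) (AdeleRing (𝓞 (Fp L)) (Fp L))))⁻¹))
            (((gramR L e dV hdV dW hdW).map (algebraMap (Fp L) (AdeleRing (𝓞 (Fp L)) (Fp L)))) * (-((blk L e dV hdV dW hdW (locToAdelic L e dV hdV dW hdW v z)).toBlocks₁₂) - ((blk L e dV hdV dW hdW (locToAdelic L e dV hdV dW hdW v z)).toBlocks₁₂)).map (im (quadraticAdeleEquiv (Fp L) L (IsCMField.complexConj L) (complexConj_imagUnit L) (imagUnit_ne_zero L)).toAddEquiv)) (((gramR L e dV hdV dW hdW).map (algebraMap (Fp L) (AdeleRing (𝓞 (Fp L)) (Fp L)))) * (-((blk L e dV hdV dW hdW (locToAdelic L e dV hdV dW hdW v z)).toBlocks₁₂) - ((blk L e dV hdV dW hdW (locToAdelic L e dV hdV dW hdW v z)).toBlocks₁₂)).map (re (quadraticAdeleEquiv (Fp L) L (IsCMField.complexConj L) (complexConj_imagUnit L) (imagUnit_ne_zero L)).toAddEquiv) * ((gramR L e dV hdV dW hdW).map (algebraMap (Fp L) (AdeleRing (𝓞 (Fp L)) (Fp L))))⁻¹) *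
          Matrix.fromBlocks ((⅟(2 : (AdeleRing (𝓞 (Fp L)) (Fp L)))) • (1 : Matrix (Fin n) (Fin n) (AdeleRing (𝓞 (Fp L)) (Fp L)))) 0 0 1))))).map
        (RingHom.snd (InfiniteAdeleRing (Fp L)) (FiniteAdeleRing (𝓞 (Fp L)) (Fp L)))) x =
      ((adeleAddCharAt (Fp L) v (Algebra.trace (v.adicCompletion (Fp L)) (LocalRing L v) (Matrix.trace
        (((algebraMap L (LocalRing L v) (imagUnit L)) • ((((blk L e dV hdV dW hdW (locToAdelic L e dV hdV dW hdW v z)).toBlocks₁₂).map (fun t : AdeleRing (𝓞 L) L => finiteAdeleToLocal L v t.2)) * (((gramR L e dV hdV dW hdW).map (algebraMap (Fp L) L)).map (algebraMap L (LocalRing L v)))⁻¹)) *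
          (toLocalRing L v (((a' : Fp L) : (v.adicCompletion (Fp L))) / (4 * ((imagUnitSq L : Fp L) : (v.adicCompletion (Fp L))))) •
            Matrix.vecMulVec (conjLocal L (IsCMField.complexConj L) v ∘ (fun i : Fin n => toLocalRing L v (((fun i : Fin n => x (((Equiv.prodUnique (Fin (n + n)) (Fin 1)).symm.trans e₁) (e₂ (n := n) (Sum.inl i))) v) ᵥ* ((gramR L e dV hdV dW hdW).map (algebraMap (Fp L) (v.adicCompletion (Fp L))))) i) - 2 * (toLocalRing L v ((fun i : Fin n => x (((Equiv.prodUnique (Fin (n + n)) (Fin 1)).symm.trans e₁) (e₂ (n := n) (Sum.inr i))) v) i) * (algebraMap L (LocalRing L v) (imagUnit L)))))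
              (fun i : Fin n => toLocalRing L v (((fun i : Fin n => x (((Equiv.prodUnique (Fin (n + n)) (Fin 1)).symm.trans e₁) (e₂ (n := n) (Sum.inl i))) v) ᵥ* ((gramR L e dV hdV dW hdW).map (algebraMap (Fp L) (v.adicCompletion (Fp L))))) i) - 2 * (toLocalRing L v ((fun i : Fin n => x (((Equiv.prodUnique (Fin (n + n)) (Fin 1)).symm.trans e₁) (e₂ (n := n) (Sum.inr i))) v) i) * (algebraMap L (LocalRing L v) (imagUnit L)))))))) : Circle) : ℂ) := by
  haveI : Algebra.IsQuadraticExtension (Fp L) L := IsCMField.isQuadraticExtension L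
  -- the local Gram matrix `T_v` over `L⁺_v`: symmetric, unit determinant; `T_v ⊗ 1 = T_vL`
  have hTvt : ((gramR L e dV hdV dW hdW).map (algebraMap (Fp L) (v.adicCompletion (Fp L))))ᵀ = ((gramR L e dV hdV dW hdW).map (algebraMap (Fp L) (v.adicCompletion (Fp L)))) := by
    rw [← Matrix.transpose_map, (gramR_isSymm L e dV hdV dW hdW).eq]
  have hTv : IsUnit ((gramR L e dV hdV dW hdW).map (algebraMap (Fp L) (v.adicCompletion (Fp L)))).det := by
    rw [← RingHom.mapMatrix_apply, ← RingHom.map_det]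
    exact (isUnit_det_gram (Fp L) e (isUnit_det_realDiagonal L dV hdV hdV0) (isUnit_det_realDiagonal L dW hdW hdW0)).map _
  have hTvL : ((gramR L e dV hdV dW hdW).map (algebraMap (Fp L) (v.adicCompletion (Fp L)))).map (toLocalRing L v) = (((gramR L e dV hdV dW hdW).map (algebraMap (Fp L) L)).map (algebraMap L (LocalRing L v))) := by
    rw [Matrix.map_map, Matrix.map_map]
    exact congrArg (gramR L e dV hdV dW hdW).map (funext fun t => toLocalRing_coe L v t)
  -- (1) drop `1ᵀ`
  rw [Matrix.transpose_one, Matrix.one_mul]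
  -- (2) the finite part is the place-`v` inclusion of the `v`-component
  have hoff : ∀ w : HeightOneSpectrum (𝓞 (Fp L)), w ≠ v →
      ((-⅟(2 : (AdeleRing (𝓞 (Fp L)) (Fp L)))) • Matrix.reindex ((Equiv.prodUnique (Fin (n + n)) (Fin 1)).symm.trans e₁) ((Equiv.prodUnique (Fin (n + n)) (Fin 1)).symm.trans e₁)
          (Matrix.reindex (e₂ (n := n)) (e₂ (n := n))
          ((algebraMap (Fp L) (AdeleRing (𝓞 (Fp L)) (Fp L)) (a' : Fp L)) •
          (Matrix.fromBlocks 0 1 (-((2 : (AdeleRing (𝓞 (Fp L)) (Fp L))) • (1 : Matrix (Fin n) (Fin n) (AdeleRing (𝓞 (Fp L)) (Fp L))))) 0 *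
          Matrix.fromBlocks ((-((blk L e dV hdV dW hdW (locToAdelic L e dV hdV dW hdW v z)).toBlocks₁₂) - ((blk L e dV hdV dW hdW (locToAdelic L e dV hdV dW hdW v z)).toBlocks₁₂)).map (re (quadraticAdeleEquiv (Fp L) L (IsCMField.complexConj L) (complexConj_imagUnit L) (imagUnit_ne_zero L)).toAddEquiv)) ((algebraMap (Fp L) (AdeleRing (𝓞 (Fp L)) (Fp L)) (imagUnitSq L)) • ((-((blk L e dV hdV dW hdW (locToAdelic L e dV hdV dW hdW v z)).toBlocks₁₂) - ((blk L e dV hdV dW hdW (locToAdelic L e dV hdV dW hdW v z)).toBlocks₁₂)).map (im (quadraticAdeleEquiv (Fp L) L (IsCMField.complexConj L) (complexConj_imagUnit L) (imagUnit_ne_zero L)).toAddEquiv) * ((gramR L e dV hdV dW hdW).map (algebraMap (Fp L) (AdeleRing (𝓞 (Fp L)) (Fp L))))⁻¹))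
            (((gramR L e dV hdV dW hdW).map (algebraMap (Fp L) (AdeleRing (𝓞 (Fp L)) (Fp L)))) * (-((blk L e dV hdV dW hdW (locToAdelic L e dV hdV dW hdW v z)).toBlocks₁₂) - ((blk L e dV hdV dW hdW (locToAdelic L e dV hdV dW hdW v z)).toBlocks₁₂)).map (im (quadraticAdeleEquiv (Fp L) L (IsCMField.complexConj L) (complexConj_imagUnit L) (imagUnit_ne_zero L)).toAddEquiv)) (((gramR L e dV hdV dW hdW).map (algebraMap (Fp L) (AdeleRing (𝓞 (Fp L)) (Fp L)))) * (-((blk L e dV hdV dW hdW (locToAdelic L e dV hdV dW hdW v z)).toBlocks₁₂) - ((blk L e dV hdV dW hdW (locToAdelic L e dV hdV dW hdW v z)).toBlocks₁₂)).map (re (quadraticAdeleEquiv (Fp L) L (IsCMField.complexConj L) (complexConj_imagUnit L) (imagUnit_ne_zero L)).toAddEquiv) * ((gramR L e dV hdV dW hdW).map (algebraMap (Fp L) (AdeleRing (𝓞 (Fp L)) (Fp L))))⁻¹) *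
          Matrix.fromBlocks ((⅟(2 : (AdeleRing (𝓞 (Fp L)) (Fp L)))) • (1 : Matrix (Fin n) (Fin n) (AdeleRing (𝓞 (Fp L)) (Fp L)))) 0 0 1)))).map (AdelicGroupData.adeleEval (Fp L) w) = 0 := by
    intro w hw
    rw [Matrix.map_smul' _ _ _ (map_mul _), map_reindex, map_reindex, map_adeleEval_chirpMatrix_of_ne L e dV hdV dW hdW v hdV0 hdW0 a' z w hw,
      reindex_zero, reindex_zero, smul_zero]
  rw [map_snd_eq_map_single L v _ hoff, K2LiuFinChirpLocalReading.finSdChar_map_finiteAdeleSingleHom]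
  congr 2
  -- (3) the `v`-component and its quadratic form
  have hZ : (-((blk L e dV hdV dW hdW (locToAdelic L e dV hdV dW hdW v z)).toBlocks₁₂) - ((blk L e dV hdV dW hdW (locToAdelic L e dV hdV dW hdW v z)).toBlocks₁₂)).map (fun t : AdeleRing (𝓞 L) L => finiteAdeleToLocal L v t.2) = -(((blk L e dV hdV dW hdW (locToAdelic L e dV hdV dW hdW v z)).toBlocks₁₂).map (fun t : AdeleRing (𝓞 L) L => finiteAdeleToLocal L v t.2)) - (((blk L e dV hdV dW hdW (locToAdelic L e dV hdV dW hdW v z)).toBlocks₁₂).map (fun t : AdeleRing (𝓞 L) L => finiteAdeleToLocal L v t.2)) :=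
    Matrix.ext fun i j => by
      have hs2 : ∀ a b : AdeleRing (𝓞 L) L, (a - b).2 = a.2 - b.2 := fun _ _ => rfl
      have hn2 : ∀ a : AdeleRing (𝓞 L) L, (-a).2 = -a.2 := fun _ => rfl
      simp only [Matrix.map_apply, Matrix.sub_apply, Matrix.neg_apply, hs2, hn2, map_sub, map_neg]
  have h2 : (2 : (v.adicCompletion (Fp L))) * AdelicGroupData.adeleEval (Fp L) v (⅟(2 : (AdeleRing (𝓞 (Fp L)) (Fp L)))) = 1 := by
    rw [← map_ofNat (AdelicGroupData.adeleEval (Fp L) v) 2, ← map_mul, mul_invOf_self, map_one]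
  rw [Matrix.map_smul' _ _ _ (map_mul _), map_reindex, map_reindex, map_adeleEval_chirpMatrix L e dV hdV dW hdW hdV0 hdW0 a' v, hZ, map_neg]
  rw [show ∀ (c : (v.adicCompletion (Fp L))) (M : Matrix (Fin n ⊕ Fin n) (Fin n ⊕ Fin n) (v.adicCompletion (Fp L))),
      c • Matrix.reindex ((Equiv.prodUnique (Fin (n + n)) (Fin 1)).symm.trans e₁) ((Equiv.prodUnique (Fin (n + n)) (Fin 1)).symm.trans e₁) (Matrix.reindex (e₂ (n := n)) (e₂ (n := n)) M) =
        Matrix.reindex ((Equiv.prodUnique (Fin (n + n)) (Fin 1)).symm.trans e₁) ((Equiv.prodUnique (Fin (n + n)) (Fin 1)).symm.trans e₁) (Matrix.reindex (e₂ (n := n)) (e₂ (n := n)) (c • M)) from fun _ _ => rfl,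
    vecMul_reindex_dotProduct, vecMul_reindex_dotProduct, ← sumElim_comp_inl_inr (((fun i => x i v) ∘ ((Equiv.prodUnique (Fin (n + n)) (Fin 1)).symm.trans e₁)) ∘ (e₂ (n := n))), ← hTvL,
    ← map_nonsing_inv_eq (toLocalRing L v) _ hTv]
  exact K2LiuFinChirpLocalGramReading.chirpGram_eq_trace_of_blocks (Fp L) L v (IsCMField.complexConj L) (complexConj_imagUnit L) (imagUnit_ne_zero L)
    (imagUnit_mul_self L) (((blk L e dV hdV dW hdW (locToAdelic L e dV hdV dW hdW v z)).toBlocks₁₂).map (fun t : AdeleRing (𝓞 L) L => finiteAdeleToLocal L v t.2)) ((gramR L e dV hdV dW hdW).map (algebraMap (Fp L) (v.adicCompletion (Fp L)))) hTvt hTv _ _ ((a' : Fp L) : (v.adicCompletion (Fp L))) _ h2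

end Instance

end Summit.HodgeConjecture.HodgeConjecture.Cruxes.HLiu418.K2LiuFinLineModelLettersAtPlaceC

end
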